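import Summits.QuantumFields.YangMills.Theorems.BalabanUVNodesN22LastCouplingHolo
import Literature.MathematicalPhysics.QuantumFieldTheory.Balaban1983to89.B12CouplingClausesHistory

/-!
# BalabanUVNodes ∕ N22 = NE9, THE QUANTITATIVE ROUTE IN THE LAST COUPLING — companion of `BalabanUVNodesN22LastCouplingHolo`: the typed disc
# read in the typer's HISTORY-EXPLICIT printed-clause currency `B12CouplingClausesHistory` ([Balaban1987RG1] p. 263 «C^∞ (or analytic) in
# g_{j−1}», p. 266 «analytic functions of the effective coupling constants»), for the MARKOV LIFT of the small-field tower's terms; and along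
# node N09's FINITE family `∀ k < K, EHoloAt T c k` (one pair `(E₀, r)`, one modulus, for the run)
# (Track A, DAG node N22; cluster K3 `SpineGivenEndpointR11`; seat `pub-ymgap-dag-n22-d`, R134 strategy s3)

HONEST FRAMING.  Count-neutral kernel bookkeeping (three seats' currencies joined BY NAME: `B12BetaHolo.EHoloAt` — node N09's per-step typed disc —,
lit-balaban-type-NE-I's `B12CouplingClausesHistory` clauses, and this seat's age-0 letters); NOT a node discharge; NE9 NOT IN PRINT; one finite
four-torus programme at fixed ε; nothing continuum ∕ ℝ⁴ ∕ OS ∕ mass-gap ∕ Clay.  0 `sorry`, 0 `def`, standard axioms.  `--supports` item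
`SpineGivenEndpointR11` (route «BalabanUVNodes», rev 6).

THE MARKOV LIFT (written inline, no definition).  The small-field tower types the localized term as `T.E j X g φ` — a function of ONE real coupling,
the last one (`Step.SFTower.E`; print p. 263 «C^∞-function of g_{j−1}»).  Read as a history functional in the typer's shape
`(ℕ → ℝ) → Φ → Dom → ℂ` it is `fun h φ ⟨j, X⟩ ↦ T.E j X (h (j − 1)) φ` on `Dom = Σ j, (T.sys j).Dom`, `scale ⟨j, X⟩ = j`, spaces
`sp ⟨j, X⟩ = Uᶜ_j(X, α₀, α₁)`.  For this lift:
* `analyticInLast263_of_eHolo` ∕ `smoothInLast263_of_eHolo` — a family of typed discs `S k : EHoloAt T c k` (all levels) DELIVERS the printed p. 263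
  clause in history-explicit form, `AnalyticInLast263 W [0, γ] scale sp (lift)` and `SmoothInLast263 …`, for EVERY history set `W` (the lift reads no
  older coordinate): `EHoloAt.eAnalyticAt` ∕ `eSmoothAt` BY NAME.
* `norm_sub_lastSection_le_of_eHolo` — the quantitative form the clauses do not carry: the last-coupling section of the lift at `⟨k+1, X⟩` is
  `((S k).E₀ ∕ (S k).r)·e^{−κ d_{k+1}(X)}`-Lipschitz on `[0, γ]` (`norm_sub_lastCoupling_le_of_eHolo`).
* `analyticInEachCoupling266_of_eHolo` — HONEST GUARD: for the Markov lift the PLURAL clause of p. 266 (`AnalyticInEachCoupling266`: every young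
  coupling) ALSO follows from the typed discs, because every OLDER-coupling section of the lift is CONSTANT — the kernel form of «memory idle in the
  Markov typing» (`BalabanUVNodesN22LastCouplingHolo` §4): the printed plural sentence has content only on a history-typed object (W1 =
  [Balaban1988RG2Cluster] §2 (2.13)–(2.14), seat `node00-def-W1`), where the older sections are NOT constant and their analyticity is node N22's
  unprinted residual (n22-c's activity-strip slot).  Nothing here claims anything about that object.
* JUNCTION WITH NODE N09's FINITE FAMILY: `exists_uniform_typedDisc` — along `hE : ∀ k < K, EHoloAt T c k` (the hypothesis of
  `B12NodeKnit.b12_main_of_up_frameOf_of_b13Family_eHolo`) a common pair `(E₀, r)` exists (finite max ∕ min), hence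
  `exists_lastCouplingModulus_of_eHolo_family` — ONE last-coupling modulus `E₀∕r` for the whole run.  HONEST: K-dependent bookkeeping for one run of
  the fixed-ε programme; uniformity in `K` is the displayed content of `norm_sub_lastCoupling_le_uniform_of_eHolo`, not claimed.

References (TYPES only): [Balaban1987RG1] = T. Bałaban, Commun. Math. Phys. **109** (1987) 249–301 — p. 256, (1.18) and the C^∞ ∕ analytic clause
p. 263, p. 266 (after (2.9)), p. 298.
-/

noncomputable section

namespace Summit.QuantumFields.YangMills.BalabanUVNodes.N22LastCouplingHolo

open Set Metric Complex
open Literature.MathematicalPhysics.QuantumFieldTheory.Balaban1983to89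
open Literature.MathematicalPhysics.QuantumFieldTheory.Balaban1983to89.Step
open Literature.MathematicalPhysics.QuantumFieldTheory.Balaban1983to89.B12BetaHolo
open Literature.MathematicalPhysics.QuantumFieldTheory.Balaban1983to89.B12CouplingClausesHistory
  (AnalyticInLast263 SmoothInLast263 AnalyticInEachCoupling266)

variable {P : Params} {G : Type*} [GaugeGroup G] {Φ 𝒢 : Type*} {T : SFTower P G Φ 𝒢} {c : SFConsts}

/-- The lift's last-coupling section at `⟨i+1, X⟩` is the tower's section: `(h[i := s]) ((i+1) − 1) = s`. [folklore] -/
theorem lift_lastSection_apply (h : ℕ → ℝ) (i : ℕ) (s : ℝ) (X : (T.sys (i + 1)).Dom) (φ : Φ) :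
    T.E (i + 1) X (Function.update h i s (i + 1 - 1)) φ = T.E (i + 1) X s φ := by
  rw [Nat.add_sub_cancel, Function.update_self]

/-- The lift's OLDER-coupling sections are constant: for `i + 1 < j`, `(h[i := s]) (j − 1) = h (j − 1)`. [folklore] -/
theorem lift_olderSection_apply (h : ℕ → ℝ) {i j : ℕ} (hij : i + 1 < j) (s : ℝ) (X : (T.sys j).Dom) (φ : Φ) :
    T.E j X (Function.update h i s (j - 1)) φ = T.E j X (h (j - 1)) φ := by
  rw [Function.update_of_ne (by omega : j - 1 ≠ i)]

/-- **THE TYPED DISCS DELIVER THE PRINTED p. 263 «(or analytic)» CLAUSE, HISTORY-EXPLICIT FORM, FOR THE MARKOV LIFT.**  A family `S k : EHoloAt T c k`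
gives `AnalyticInLast263 W [0, γ] scale sp (fun h φ ⟨j, X⟩ ↦ T.E j X (h (j−1)) φ)` for every history set `W` — the last-coupling section at
`⟨k+1, X⟩`, `φ ∈ Uᶜ_{k+1}(X, α₀, α₁)`, is real-analytic within `[0, γ]` (`EHoloAt.eAnalyticAt` BY NAME).
[cite: Balaban1987RG1, p.263 (clause before (1.18)) with p.266 (after (2.9))] -/
theorem analyticInLast263_of_eHolo (S : ∀ k, EHoloAt T c k) (W : Set (ℕ → ℝ)) :
    AnalyticInLast263 W (Icc (0 : ℝ) c.γ) (fun X : (Σ j, (T.sys j).Dom) => X.1) (fun X => T.space X.1 X.2 c.α₀ c.α₁)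
      (fun (h : ℕ → ℝ) (φ : Φ) (X : Σ j, (T.sys j).Dom) => T.E X.1 X.2 (h (X.1 - 1)) φ) := by
  rintro ⟨j, X⟩ φ hφ h _ i hi
  dsimp only at hφ hi ⊢
  subst hi
  have e : (fun s : ℝ => T.E (i + 1) X (Function.update h i s (i + 1 - 1)) φ) = fun s : ℝ => T.E (i + 1) X s φ :=
    funext fun s => lift_lastSection_apply h i s X φ
  rw [e]
  exact (S i).eAnalyticAt X φ hφ

/-- **… AND THE PRINTED p. 263 «C^∞» CLAUSE, HISTORY-EXPLICIT FORM**: `SmoothInLast263 W [0, γ] scale sp (lift)` for every `W`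
(`EHoloAt.eSmoothAt` BY NAME). [cite: Balaban1987RG1, p.263 (clause before (1.18))] -/
theorem smoothInLast263_of_eHolo (S : ∀ k, EHoloAt T c k) (W : Set (ℕ → ℝ)) :
    SmoothInLast263 W (Icc (0 : ℝ) c.γ) (fun X : (Σ j, (T.sys j).Dom) => X.1) (fun X => T.space X.1 X.2 c.α₀ c.α₁)
      (fun (h : ℕ → ℝ) (φ : Φ) (X : Σ j, (T.sys j).Dom) => T.E X.1 X.2 (h (X.1 - 1)) φ) := by
  rintro ⟨j, X⟩ φ hφ h _ i hi n
  dsimp only at hφ hi ⊢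
  subst hi
  have e : (fun s : ℝ => T.E (i + 1) X (Function.update h i s (i + 1 - 1)) φ) = fun s : ℝ => T.E (i + 1) X s φ :=
    funext fun s => lift_lastSection_apply h i s X φ
  rw [e]
  exact (S i).eSmoothAt X φ hφ n

/-- **THE QUANTITATIVE FORM THE PRINTED CLAUSES DO NOT CARRY**: the last-coupling section of the lift at `⟨k+1, X⟩` (`φ ∈ Uᶜ_{k+1}(X, α₀, α₁)`, any
history `h`, `γ > 0`) is Lipschitz on `[0, γ]` with constant `((S k).E₀ ∕ (S k).r)·e^{−κ d_{k+1}(X)}` — `norm_sub_lastCoupling_le_of_eHolo` read in the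
history-explicit shape. [cite: Balaban1987RG1, p.263 (clause before (1.18)) with (1.18) and p.266 (after (2.9))] -/
theorem norm_sub_lastSection_le_of_eHolo (hγ : 0 < c.γ) {k : ℕ} (S : EHoloAt T c k) (X : (T.sys (k + 1)).Dom) {φ : Φ}
    (hφ : φ ∈ T.space (k + 1) X c.α₀ c.α₁) (h : ℕ → ℝ) {s s' : ℝ} (hs : s ∈ Icc (0 : ℝ) c.γ) (hs' : s' ∈ Icc (0 : ℝ) c.γ) :
    ‖T.E (k + 1) X (Function.update h k s (k + 1 - 1)) φ - T.E (k + 1) X (Function.update h k s' (k + 1 - 1)) φ‖ ≤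
      S.E₀ / S.r * Real.exp (-c.κ * (T.sys (k + 1)).dj X) * |s - s'| := by
  rw [lift_lastSection_apply, lift_lastSection_apply]
  exact norm_sub_lastCoupling_le_of_eHolo hγ S X hφ hs hs'

/-- **HONEST GUARD — FOR THE MARKOV LIFT THE PLURAL CLAUSE OF p. 266 IS AUTOMATIC BEYOND THE LAST COUPLING.**  A family `S k : EHoloAt T c k` gives
`AnalyticInEachCoupling266 W [0, γ] scale sp (lift)` — EVERY young-coupling section analytic — because the sections in the OLDER couplings
`i + 1 < j` are CONSTANT (`lift_olderSection_apply`) and the last one is `analyticInLast263_of_eHolo`.  This is the kernel form of «memory idle in the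
Markov typing»: on the small-field tower's terms the printed plural sentence carries no information beyond p. 263; its content lives on a
history-typed object (W1), untouched here. [cite: Balaban1987RG1, p.266 (after (2.9)) with p.263 (clause before (1.18)) and p.256] -/
theorem analyticInEachCoupling266_of_eHolo (S : ∀ k, EHoloAt T c k) (W : Set (ℕ → ℝ)) :
    AnalyticInEachCoupling266 W (Icc (0 : ℝ) c.γ) (fun X : (Σ j, (T.sys j).Dom) => X.1) (fun X => T.space X.1 X.2 c.α₀ c.α₁)
      (fun (h : ℕ → ℝ) (φ : Φ) (X : Σ j, (T.sys j).Dom) => T.E X.1 X.2 (h (X.1 - 1)) φ) := by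
  rintro ⟨j, X⟩ φ hφ h hh i hi
  dsimp only at hφ hi ⊢
  rcases Nat.lt_or_ge (i + 1) j with hlt | hge
  · -- an OLDER coupling: the section is constant
    have e : (fun s : ℝ => T.E j X (Function.update h i s (j - 1)) φ) = fun _ : ℝ => T.E j X (h (j - 1)) φ :=
      funext fun s => lift_olderSection_apply h hlt s X φ
    rw [e]
    exact analyticOn_const
  · -- the LAST coupling
    have hij : i + 1 = j := le_antisymm (Nat.succ_le_of_lt hi) hge
    exact analyticInLast263_of_eHolo S W ⟨j, X⟩ φ hφ h hh i hij

/-! ## Junction with node N09's FINITE family `∀ k < K, EHoloAt T c k`: one pair `(E₀, r)` for the run -/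

/-- **A FINITE FAMILY OF TYPED DISCS HAS A COMMON PAIR `(E₀, r)`**: along node N09's hypothesis `hE : ∀ k < K, EHoloAt T c k`
(`B12NodeKnit.b12_main_of_up_frameOf_of_b13Family_eHolo`) there are `E₀` and `r > 0` with `(S k).E₀ ≤ E₀` and `r ≤ (S k).r` for every `k < K`
(finite max ∕ min).  HONEST: the pair so obtained DEPENDS ON `K` — it is bookkeeping for ONE run of the fixed-ε programme; uniformity in `K` (the
UV question) is exactly the content of the displayed hypotheses of `norm_sub_lastCoupling_le_uniform_of_eHolo` and is NOT claimed. [folklore] -/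
theorem exists_uniform_typedDisc {K : ℕ} (S : ∀ k, k < K → EHoloAt T c k) :
    ∃ E₀ r : ℝ, 0 < r ∧ ∀ k (hk : k < K), (S k hk).E₀ ≤ E₀ ∧ r ≤ (S k hk).r := by
  induction K with
  | zero => exact ⟨0, 1, one_pos, fun k hk => absurd hk (Nat.not_lt_zero k)⟩
  | succ K ih =>
    obtain ⟨E₀, r, hr, h⟩ := ih fun k hk => S k (Nat.lt_succ_of_lt hk)
    refine ⟨max E₀ (S K (Nat.lt_succ_self K)).E₀, min r (S K (Nat.lt_succ_self K)).r,
      lt_min hr (S K (Nat.lt_succ_self K)).r_pos, fun k hk => ?_⟩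
    rcases Nat.lt_succ_iff_lt_or_eq.1 hk with hlt | heq
    · exact ⟨(h k hlt).1.trans (le_max_left _ _), (min_le_left _ _).trans (h k hlt).2⟩
    · subst heq
      exact ⟨le_max_right _ _, min_le_right _ _⟩

/-- **ONE LAST-COUPLING MODULUS FOR THE WHOLE RUN.**  Along `∀ k < K, EHoloAt T c k` (`γ > 0`) there are `E₀`, `r > 0` such that for every `k < K`,
`φ ∈ Uᶜ_{k+1}(X, α₀, α₁)` and `g, g′ ∈ [0, γ]`: `‖E^{(k+1)}(X, g, φ) − E^{(k+1)}(X, g′, φ)‖ ≤ (E₀∕r)·e^{−κ d_{k+1}(X)}·|g − g′|`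
(`exists_uniform_typedDisc` + `norm_sub_lastCoupling_le_uniform_of_eHolo`).  K-dependent, as said. [cite: Balaban1987RG1, p.263 (clause before (1.18)) with Thm 3 p.264] -/
theorem exists_lastCouplingModulus_of_eHolo_family (hγ : 0 < c.γ) {K : ℕ} (S : ∀ k, k < K → EHoloAt T c k) :
    ∃ E₀ r : ℝ, 0 < r ∧ ∀ k (hk : k < K) (X : (T.sys (k + 1)).Dom) (φ : Φ), φ ∈ T.space (k + 1) X c.α₀ c.α₁ →
      ∀ g ∈ Icc (0 : ℝ) c.γ, ∀ g' ∈ Icc (0 : ℝ) c.γ,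
        ‖T.E (k + 1) X g φ - T.E (k + 1) X g' φ‖ ≤ E₀ / r * Real.exp (-c.κ * (T.sys (k + 1)).dj X) * |g - g'| := by
  obtain ⟨E₀, r, hr, h⟩ := exists_uniform_typedDisc S
  exact ⟨E₀, r, hr, fun k hk X φ hφ g hg g' hg' =>
    norm_sub_lastCoupling_le_uniform_of_eHolo hγ S hr (fun k hk => (h k hk).1) (fun k hk => (h k hk).2) hk X hφ hg hg'⟩

end Summit.QuantumFields.YangMills.BalabanUVNodes.N22LastCouplingHolo

end
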